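/-
HONEST FRAMING: certified error envelopes and provably optimal rounding/accumulation schemes for
low-precision formats under stated cost models; every table by two implementations; no hardware
or vendor claims.
-/
import Summits.Ventures.CertifiedArithmetic.LowPrec.OptDemotionMonoW
import Summits.Ventures.CertifiedArithmetic.LowPrec.OptDemotionMonoWCover

/-!
# The demotion law (Theorem T8), part 6h: the node step for SPINE configurations from MONO

HOME `CONJECTURE-D-NODESTEP.md` §G10.2 (i): at a node `a·b` with computed value
`v = fl(v_a + v_b) ∈ [σ, 2σ)`, if the child `a` sits in the root binade (`v_a ≥ σ`, a SPINE
configuration) then the node deficit is covered by a line of the full family `L_{a·b}` provided the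
squeezed child `b` satisfies MONO — in the z-form `MonoZTree q b` of this file
(`B_b(z) ≤ ψ_b(z)`: the cap of `b` at value `z + u`, read at its true scale, is below opt's
pseudo-scale reading `z·G_b(u/z)`, for every grid `z = 2ju`, `1 ≤ j < 2^(q-1)`; equivalent to part
6f's `MonoTree` by reindexing `z + u = ufp(z+u)(1 + ε(2k+1))`).

* `MonoZPt`, `MonoZTree` (+ computable twin `MonoZTreeC`, `monoZTreeC_iff`, kernel certificates for
  the two GOOD-ACTIVE failures `opt37` (q = 4) and `gaCex43` (q = 5));
* `envG_nonneg`, `envG_ge_mu`, `line_le_envG` — envelope bookkeeping;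
* **`node_line_spine`** — the float-level node step in CASE I (`2^K ≤ v_a`): from the children's
  invariant lines `ℓ_a, ℓ_b` and `MonoZTree q b`, a line `ℓ ∈ L_{a·b}` with
  `d_a + d_b + (v_a + v_b - v) ≤ 2^K(ℓ.1 - ℓ.2) + ℓ.2·v`.  Ingredients: the grid of the top binade
  (`isFloat_grid`), `|v - (v_a+v_b)| ≤ uσ` (`round_sum_facts`), monotonicity of the cap of `b` up to
  the value `z + uσ` (`z = v - v_a`), `MonoZPt` at `j = z/(2uσ)`, and part 6g's `spine_cover_lines`.
The both-below case (CASE III, from W) and the assembly into a class theorem are the remaining steps.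
-/

namespace Summit.Ventures.CertifiedArithmetic.LowPrec.Opt

open Literature.ComputerArithmetic.JeannerodRump2018
open Literature.ComputerArithmetic.JeannerodRump2018.SumTree
open Demotion

/-! ## MONO in z-form -/

/-- **MONO, z-form, one point**: `B_t(z) ≤ ψ_t(z)` for `z = 2ju`:
`ufp(z+u)·G_t((z+u)/ufp(z+u) - 1) ≤ z·G_t(u/z)` (`ufp((2j+1)u) = betaOf u j`, `u/z = 1/(2j)`). -/
def MonoZPt (u : ℚ) (t : SumTree) (j : ℕ) : Prop :=
  betaOf u j * envG u t ((2 * (j : ℚ) + 1) * u / betaOf u j - 1)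
    ≤ 2 * (j : ℚ) * u * envG u t (1 / (2 * (j : ℚ)))

/-- **MONO, z-form, for the tree `t` at precision `q`**: all grid `z = 2ju`, `1 ≤ j < 2^(q-1)`. -/
def MonoZTree (q : ℕ) (t : SumTree) : Prop :=
  ∀ j : ℕ, 1 ≤ j → j < 2 ^ (q - 1) → MonoZPt (unitRoundoff q) t j

/-- Computable twin of `MonoZPt`. -/
def monoZPtC (u : ℚ) (t : SumTree) (j : ℕ) : Bool :=
  decide (betaOf u j * ((treeQMQ u t ((2 * (j : ℚ) + 1) * u / betaOf u j - 1)).2.1 - 1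
      - ((2 * (j : ℚ) + 1) * u / betaOf u j - 1))
    ≤ 2 * (j : ℚ) * u * ((treeQMQ u t (1 / (2 * (j : ℚ)))).2.1 - 1 - 1 / (2 * (j : ℚ))))

/-- Computable twin of `MonoZTree`. -/
def MonoZTreeC (q : ℕ) (t : SumTree) : Prop :=
  ∀ j : ℕ, 1 ≤ j → j < 2 ^ (q - 1) → monoZPtC (unitRoundoff q) t j = true

/-- `MonoZTreeC` is decidable. -/
instance (q : ℕ) (t : SumTree) : Decidable (MonoZTreeC q t) := by unfold MonoZTreeC; infer_instance

/-- The computable twin agrees with `MonoZPt`. -/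
theorem monoZPtC_iff {u : ℚ} (hu : u ≠ 0) (t : SumTree) (j : ℕ) :
    monoZPtC u t j = true ↔ MonoZPt u t j := by
  simp only [monoZPtC, treeQMQ_spec hu, MonoZPt, envG, decide_eq_true_eq]

/-- `MonoZTreeC ↔ MonoZTree`. -/
theorem monoZTreeC_iff (q : ℕ) (t : SumTree) : MonoZTreeC q t ↔ MonoZTree q t := by
  simp only [MonoZTreeC, MonoZTree, monoZPtC_iff (unitRoundoff_ne_zero q)]

/-- Kernel certificates: both GOOD-ACTIVE failures satisfy MONO in z-form. -/
theorem monoZ_opt37_gaCex43 : MonoZTreeC 4 opt37 ∧ MonoZTreeC 5 gaCex43 := by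
  decide +kernel

/-- Propositional form of the certificates. -/
theorem monoZTree_opt37_gaCex43 : MonoZTree 4 opt37 ∧ MonoZTree 5 gaCex43 :=
  ⟨(monoZTreeC_iff 4 opt37).mp monoZ_opt37_gaCex43.1,
   (monoZTreeC_iff 5 gaCex43).mp monoZ_opt37_gaCex43.2⟩

/-! ## Envelope bookkeeping -/

/-- Every line of `L_t` is below the envelope: `α + λρ ≤ G_t(ρ)` (`ρ ≥ 0`). -/
theorem line_le_envG {u : ℚ} (hu : 0 < u) (hu1 : u ≤ 1) (t : SumTree) {l : ℚ × ℚ}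
    (hl : l ∈ allLines u t) {ρ : ℚ} (hρ : 0 ≤ ρ) : l.1 + l.2 * ρ ≤ envG u t ρ := by
  have := allLine_le_treeQf_of_nonneg hu hu1 t hl hρ
  unfold envG; linarith

/-- `μ_t ≤ G_t(ρ)` (`ρ ≥ 0`). -/
theorem envG_ge_mu {u : ℚ} (hu : 0 < u) (hu1 : u ≤ 1) (t : SumTree) {ρ : ℚ} (hρ : 0 ≤ ρ) :
    treeM u t - 1 ≤ envG u t ρ := by
  have := line_le_envG hu hu1 t (mu_mem_allLines hu.le hu1 t) hρ
  simpa using this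

/-- `0 ≤ G_t(ρ)` (`ρ ≥ 0`). -/
theorem envG_nonneg {u : ℚ} (hu : 0 < u) (hu1 : u ≤ 1) (t : SumTree) {ρ : ℚ} (hρ : 0 ≤ ρ) :
    0 ≤ envG u t ρ :=
  le_trans (by linarith [one_le_treeM hu.le t]) (envG_ge_mu hu hu1 t hρ)

/-- The envelope at `ρ > 0` is attained by a line: `G_t(ρ) = α + λρ`. -/
theorem exists_line_eq_envG {u : ℚ} (hu : 0 < u) (t : SumTree) {ρ : ℚ} (hρ : 0 < ρ) :
    ∃ l ∈ allLines u t, envG u t ρ = l.1 + l.2 * ρ := by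
  obtain ⟨l, hl, he⟩ := exists_allLine_eq_treeQf hu t ρ hρ
  exact ⟨l, hl, by unfold envG; linarith⟩

/-! ## The node step for spine configurations -/

section Node

variable {q : ℕ} {emin : ℤ} {fl : ℚ → ℚ}

/-- **THE NODE STEP, CASE I (spine configurations), FROM MONO.**  `a` in the root binade
(`2^K ≤ v_a`), `b` arbitrary (`MonoZTree q b`); children's deficits below their invariant lines
`ℓ_a ∈ L_a`, `ℓ_b ∈ L_b` at their own scales.  Then some line of `L_{a·b}` covers the node deficit
at scale `2^K`. -/
theorem node_line_spine (hq : 1 ≤ q) (hfl : IsRoundNearest q emin fl) {a b : SumTree}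
    {va vb da db : ℚ} (ha : IsFloat q emin va) (hb : IsFloat q emin vb) (hb0 : 0 ≤ vb)
    {la lb : ℚ × ℚ} (hla : la ∈ allLines (unitRoundoff q) a)
    (hlb : lb ∈ allLines (unitRoundoff q) b)
    (hda : 0 < va → da ≤ (2 : ℚ) ^ (Int.log 2 va) * (la.1 - la.2) + la.2 * va)
    (hdb0 : vb = 0 → db ≤ 0)
    (hdb : 0 < vb → db ≤ (2 : ℚ) ^ (Int.log 2 vb) * (lb.1 - lb.2) + lb.2 * vb)
    (hMb : MonoZTree q b)
    {K : ℤ} (hvlo : (2 : ℚ) ^ K ≤ fl (va + vb)) (hvhi : fl (va + vb) < (2 : ℚ) ^ (K + 1))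
    (hI : (2 : ℚ) ^ K ≤ va) :
    ∃ l ∈ allLines (unitRoundoff q) (.node a b),
      da + db + (va + vb - fl (va + vb)) ≤ (2 : ℚ) ^ K * (l.1 - l.2) + l.2 * fl (va + vb) := by
  set u := unitRoundoff q with hudef
  obtain ⟨σ, hσdef⟩ : ∃ σ : ℚ, σ = (2 : ℚ) ^ K := ⟨_, rfl⟩
  set v := fl (va + vb) with hvdef
  rw [← hσdef] at hvlo hI ⊢
  have h2 : (2 : ℚ) ≠ 0 := by norm_num
  have hσpos : 0 < σ := by rw [hσdef]; exact zpow_pos (by norm_num) _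
  have hu0 : 0 ≤ u := unitRoundoff_nonneg q
  have hupos : 0 < u := by rw [hudef]; unfold unitRoundoff; positivity
  have hu1 : u ≤ 1 := unitRoundoff_le_one q
  have hug : u * σ = (2 : ℚ) ^ (K - q) := by rw [hσdef]; exact (u_mul_zpow q K).1
  have hug2 : 2 * u * σ = (2 : ℚ) ^ (K + 1 - q) := by rw [hσdef]; exact (u_mul_zpow q K).2
  have hvpos : 0 < v := lt_of_lt_of_le hσpos hvlo
  have hvapos : 0 < va := lt_of_lt_of_le hσpos hI
  have hva0 : 0 ≤ va := hvapos.le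
  have hvav : va ≤ v := le_fl_of_isFloat_le hfl ha (le_add_of_nonneg_right hb0)
  have hvF : IsFloat q emin v := (hfl _).1
  obtain ⟨habs, -⟩ := round_sum_facts hq hfl ha hb hva0 hb0 hvhi
  rw [← hσdef] at habs
  have hsumhi : va + vb ≤ v + u * σ := by have := (abs_le.mp habs).2; linarith
  -- bounds of the lines
  obtain ⟨hla2, hla2M, hla1, hla1M⟩ := allLines_bounds hu0 hu1 a la hla
  obtain ⟨hlb2, hlb2M, hlb1, hlb1M⟩ := allLines_bounds hu0 hu1 b lb hlb
  have hMb1 : 1 ≤ treeM u b := one_le_treeM hu0 b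
  -- a's deficit at scale σ
  have hloga : Int.log 2 va = K :=
    int_log_eq_of_mem hvapos (by rw [← hσdef]; exact hI) (lt_of_le_of_lt hvav hvhi)
  have hda' : da ≤ σ * (la.1 - la.2) + la.2 * va := by
    have := hda hvapos; rwa [hloga, ← hσdef] at this
  -- b's deficit is at most μ_b · v_b
  have hdbμ : db ≤ (treeM u b - 1) * vb := by
    rcases eq_or_lt_of_le hb0 with h0 | hpos
    · have := hdb0 h0.symm; rw [← h0]; linarith
    · have hπlo : ((2 : ℕ) : ℚ) ^ (Int.log 2 vb) ≤ vb := Int.zpow_log_le_self (by norm_num) hpos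
      push_cast at hπlo
      have hπpos : (0 : ℚ) < (2 : ℚ) ^ (Int.log 2 vb) := zpow_pos (by norm_num) _
      have h1 := hdb hpos
      have e1 : (2 : ℚ) ^ (Int.log 2 vb) * (lb.1 - lb.2) + lb.2 * vb
          = (2 : ℚ) ^ (Int.log 2 vb) * lb.1 + lb.2 * (vb - (2 : ℚ) ^ (Int.log 2 vb)) := by ring
      rw [e1] at h1
      have s1 := mul_le_mul_of_nonneg_left hlb1M hπpos.le
      have s2 := mul_le_mul_of_nonneg_right hlb2M (sub_nonneg.2 hπlo)
      linarith
  -- the grid of the top binade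
  obtain ⟨N, hN⟩ := isFloat_grid hvF (by rw [← hσdef]; exact hvlo)
  obtain ⟨Na, hNa⟩ := isFloat_grid ha (by rw [← hσdef]; exact hI)
  have hgpos : (0 : ℚ) < (2 : ℚ) ^ (K + 1 - q) := zpow_pos (by norm_num) _
  rcases eq_or_lt_of_le hvav with hEq | hLt
  · -- z = 0: b is absorbed (v_b ≤ uσ); the line F1(ℓ_a) covers
    refine ⟨_, mem_allLines_F1 (b := b) hla, ?_⟩
    dsimp only
    have hvbu : vb ≤ u * σ := by rw [hEq] at hsumhi; linarith
    have hkey : db + vb ≤ treeM u b * (u * σ) := by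
      have : db + vb ≤ treeM u b * vb := by linarith
      exact this.trans (mul_le_mul_of_nonneg_left hvbu (by linarith))
    rw [← hEq]
    linarith
  · -- z ≥ 2uσ: z = j · 2uσ with 1 ≤ j < 2^(q-1)
    -- the integer j
    have hjpos : 1 ≤ N - Na := by
      have : (Na : ℚ) * (2 : ℚ) ^ (K + 1 - q) < (N : ℚ) * (2 : ℚ) ^ (K + 1 - q) := by
        rw [← hN, ← hNa]; exact hLt
      have h' := lt_of_mul_lt_mul_right this hgpos.le
      have h'' : Na < N := by exact_mod_cast h'
      omega
    obtain ⟨j, hj⟩ : ∃ j : ℕ, ((j : ℤ) = N - Na) := ⟨(N - Na).toNat, by omega⟩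
    have hj1 : 1 ≤ j := by exact_mod_cast hj ▸ hjpos
    have hjq : (j : ℚ) = (N : ℚ) - (Na : ℚ) := by exact_mod_cast hj
    have hjpos' : (0 : ℚ) < j := by
      have : (1 : ℚ) ≤ j := by exact_mod_cast hj1
      linarith
    -- z = v - va = j · 2uσ
    have hz : v - va = 2 * (j : ℚ) * u * σ := by
      rw [hN, hNa, ← hug2, hjq]; ring
    -- j < 2^(q-1): z ≤ v - σ < σ = 2^(q-1) · 2uσ
    have hxtop : v ≤ 2 * σ - 2 * u * σ := by
      have h1 := isFloat_le_top hvF hvpos hvhi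
      rw [zpow_add_one₀ h2, ← hσdef] at h1; rw [hug2]; linarith
    have hjlt : j < 2 ^ (q - 1) := by
      have hpow : (2 : ℚ) ^ q = 2 * 2 ^ (q - 1) := by
        conv_lhs => rw [← Nat.sub_add_cancel hq, pow_succ]
        ring
      have h3 : (2 : ℚ) * u * 2 ^ (q - 1) = 1 := by
        rw [hudef]; unfold unitRoundoff; rw [hpow]; field_simp
      have h4 : 2 * (j : ℚ) * u < 1 := by
        have := lt_of_mul_lt_mul_right (by linarith : 2 * (j : ℚ) * u * σ < 1 * σ) hσpos.le
        linarith
      have h5 : (j : ℚ) < 2 ^ (q - 1) := by nlinarith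
      exact_mod_cast h5
    -- y = z + uσ, its binade β_y = betaOf u j · σ = 2^(n + K - q)
    set n := Nat.log2 (2 * j + 1) with hn
    have hβ : betaOf u j = (2 : ℚ) ^ n * u := rfl
    have hβy_lo : (2 : ℚ) ^ n ≤ 2 * (j : ℚ) + 1 := by
      have h := Nat.log2_self_le (n := 2 * j + 1) (by omega)
      exact_mod_cast h
    have hβy_hi : 2 * (j : ℚ) + 1 < 2 * (2 : ℚ) ^ n := by
      have h := Nat.lt_log2_self (n := 2 * j + 1)
      rw [pow_succ] at h
      have : ((2 * j + 1 : ℕ) : ℚ) < ((2 ^ Nat.log2 (2 * j + 1) * 2 : ℕ) : ℚ) := by exact_mod_cast h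
      push_cast at this; linarith
    have hβσ : betaOf u j * σ = (2 : ℚ) ^ ((n : ℤ) + (K - q)) := by
      rw [hβ, zpow_add₀ h2, zpow_natCast, ← hug]; ring
    have hβpos : 0 < betaOf u j := betaOf_pos hupos j
    have hβσpos : 0 < betaOf u j * σ := mul_pos hβpos hσpos
    -- ξ_y ≥ 0
    obtain ⟨ξ, hξ⟩ : ∃ ξ : ℚ, ξ = (2 * (j : ℚ) + 1) * u / betaOf u j - 1 := ⟨_, rfl⟩
    have hξ0 : 0 ≤ ξ := by
      rw [hξ, sub_nonneg, le_div_iff₀ hβpos, hβ]; nlinarith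
    have hξrel : betaOf u j * σ * (1 + ξ) = (2 * (j : ℚ) + 1) * u * σ := by
      rw [hξ]; field_simp; ring
    have hvby : vb ≤ (2 * (j : ℚ) + 1) * u * σ := by linarith
    -- b's deficit below the cap at value y, true scale β_y
    have hdbcap : db ≤ betaOf u j * σ * envG u b ξ := by
      rcases eq_or_lt_of_le hb0 with h0 | hvbpos
      · have := hdb0 h0.symm
        have hG := envG_nonneg hupos hu1 b hξ0
        have : 0 ≤ betaOf u j * σ * envG u b ξ := mul_nonneg hβσpos.le hG
        linarith
      · have hπlo : ((2 : ℕ) : ℚ) ^ (Int.log 2 vb) ≤ vb := Int.zpow_log_le_self (by norm_num) hvbpos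
        have hπhi : vb < ((2 : ℕ) : ℚ) ^ (Int.log 2 vb + 1) :=
          Int.lt_zpow_succ_log_self (by norm_num) vb
        push_cast at hπlo hπhi
        obtain ⟨kb, hkb⟩ : ∃ kb : ℤ, kb = Int.log 2 vb := ⟨_, rfl⟩
        rw [← hkb] at hπlo hπhi
        have hπpos : (0 : ℚ) < (2 : ℚ) ^ kb := zpow_pos (by norm_num) _
        have h1 := hdb hvbpos
        rw [← hkb] at h1
        have e1 : (2 : ℚ) ^ kb * (lb.1 - lb.2) + lb.2 * vb
            = (2 : ℚ) ^ kb * lb.1 + lb.2 * (vb - (2 : ℚ) ^ kb) := by ring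
        rw [e1] at h1
        -- s = 2^kb < 2 β_y, hence kb ≤ n + K - q
        have huσ : 0 < u * σ := mul_pos hupos hσpos
        have hy2 : (2 * (j : ℚ) + 1) * (u * σ) < 2 * (2 : ℚ) ^ n * (u * σ) :=
          mul_lt_mul_of_pos_right hβy_hi huσ
        have hslt : (2 : ℚ) ^ kb < (2 : ℚ) ^ ((n : ℤ) + (K - q) + 1) := by
          rw [zpow_add_one₀ h2, ← hβσ, hβ]; linarith
        have hkb_le : kb ≤ (n : ℤ) + (K - q) := by
          by_contra hc
          have h3 : (2 : ℚ) ^ ((n : ℤ) + (K - q) + 1) ≤ (2 : ℚ) ^ kb :=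
            zpow_le_zpow_right₀ (by norm_num) (by omega)
          linarith
        rcases eq_or_lt_of_le hkb_le with hkeq | hklt
        · -- same binade: the line ℓ_b read at ξ
          have hs : (2 : ℚ) ^ kb = betaOf u j * σ := by rw [hkeq, hβσ]
          rw [hs] at h1
          have hline := line_le_envG hupos hu1 b hlb hξ0
          have hy : vb - betaOf u j * σ ≤ betaOf u j * σ * ξ := by linarith
          have s1 := mul_le_mul_of_nonneg_left hy hlb2
          have s2 := mul_le_mul_of_nonneg_left hline hβσpos.le
          linarith
        · -- lower binade: 2 s ≤ β_y, db ≤ 2 s μ_b ≤ β_y μ_b ≤ β_y G(ξ)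
          have h2s : (2 : ℚ) ^ (kb + 1) ≤ betaOf u j * σ := by
            rw [hβσ]; exact zpow_le_zpow_right₀ (by norm_num) (by omega)
          rw [zpow_add_one₀ h2] at h2s hπhi
          have hGμ := envG_ge_mu hupos hu1 b hξ0
          have hμ0 : 0 ≤ treeM u b - 1 := by linarith
          have s1 := mul_le_mul_of_nonneg_left hlb1M hπpos.le
          have s2 := mul_le_mul_of_nonneg_right hlb2M (by linarith : (0 : ℚ) ≤ vb - (2 : ℚ) ^ kb)
          have s3 := mul_le_mul_of_nonneg_left (by linarith : vb - (2 : ℚ) ^ kb ≤ (2 : ℚ) ^ kb) hμ0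
          have s4 := mul_le_mul_of_nonneg_right h2s hμ0
          have s5 := mul_le_mul_of_nonneg_left hGμ hβσpos.le
          linarith
    -- MONO(b) at j: the cap is below the pseudo-scale reading z·G_b(1/(2j)) = z·lb'.1 + lb'.2·uσ
    have hmono : betaOf u j * envG u b ξ ≤ 2 * (j : ℚ) * u * envG u b (1 / (2 * (j : ℚ))) := by
      rw [hξ]; exact hMb j hj1 hjlt
    have hρpos : (0 : ℚ) < 1 / (2 * (j : ℚ)) := div_pos one_pos (by linarith)
    obtain ⟨lb', hlb', hGe⟩ := exists_line_eq_envG hupos b hρpos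
    have hdbread : db ≤ lb'.1 * (2 * (j : ℚ) * u * σ) + lb'.2 * (u * σ) := by
      have hj0 : (j : ℚ) ≠ 0 := ne_of_gt hjpos'
      have e : 2 * (j : ℚ) * u * envG u b (1 / (2 * (j : ℚ))) * σ
          = lb'.1 * (2 * (j : ℚ) * u * σ) + lb'.2 * (u * σ) := by
        rw [hGe]; field_simp
      have := mul_le_mul_of_nonneg_right hmono hσpos.le
      rw [e] at this
      linarith
    -- assemble with part 6g's spine cover at x = v/σ - 1, z' = 2ju
    obtain ⟨x, hx⟩ : ∃ x : ℚ, x = v / σ - 1 := ⟨_, rfl⟩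
    have hvx : v = σ * (1 + x) := by rw [hx]; field_simp; ring
    have hxz : 2 * (j : ℚ) * u ≤ x := by
      have h1 : σ * (2 * (j : ℚ) * u) ≤ σ * x := by linarith
      exact le_of_mul_le_mul_left h1 hσpos
    have hz0' : (0 : ℚ) < 2 * (j : ℚ) * u := mul_pos (mul_pos two_pos hjpos') hupos
    have hz0 : (0 : ℚ) ≤ 2 * (j : ℚ) * u := hz0'.le
    have hcov := spine_cover_lines hupos hu1 a b hz0 hxz hla hlb'
    have hxpos : 0 < x := lt_of_lt_of_le hz0' hxz
    obtain ⟨l, hl, hle⟩ := exists_allLine_eq_treeQf hupos (.node a b) x hxpos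
    refine ⟨l, hl, ?_⟩
    -- total: T ≤ [σ la.1 + la.2 (va - σ)] + [lb'.1 z + lb'.2 uσ] + uσ ≤ σ (G_ab(x)) = σ (l.1 + l.2 x)
    have hvaσ : va = σ * (1 + x) - 2 * (j : ℚ) * u * σ := by rw [← hvx]; linarith
    have hloss : va + vb - v ≤ u * σ := by linarith
    have hda'' : da ≤ σ * la.1 + la.2 * (σ * x) - la.2 * (2 * (j : ℚ) * u * σ) := by
      rw [hvaσ] at hda'; linarith
    have hfin : σ * (u + (la.1 + la.2 * (x - 2 * (j : ℚ) * u))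
            + (lb'.1 * (2 * (j : ℚ) * u) + lb'.2 * u)) ≤ σ * (treeQf u (.node a b) x - 1 - x) :=
      mul_le_mul_of_nonneg_left hcov hσpos.le
    have hlx : σ * (treeQf u (.node a b) x - 1 - x) = σ * (l.1 - l.2) + l.2 * v := by
      rw [← hle, hvx]; ring
    have hexp : σ * (u + (la.1 + la.2 * (x - 2 * (j : ℚ) * u))
            + (lb'.1 * (2 * (j : ℚ) * u) + lb'.2 * u))
        = u * σ + (σ * la.1 + la.2 * (σ * x) - la.2 * (2 * (j : ℚ) * u * σ))
          + (lb'.1 * (2 * (j : ℚ) * u * σ) + lb'.2 * (u * σ)) := by ring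
    linarith

end Node

end Summit.Ventures.CertifiedArithmetic.LowPrec.Opt
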